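import Summits.Ventures.YMGap.Thresholds.StarWindow
import HarnessLib

/-!
# Venture YMGap — track (c) «DS»: the star door for bounded measurable local observables on one
# torus (DLR smoothing), conditional on the star window bound — first half of the currency adapter

HONEST FRAMING: venture file (cell `pub-ymgap`), strong-coupling LATTICE bookkeeping only. INPUT: the
named hypothesis schema `StarWindowBound L β_W ρ r` of `StarWindow.lean` (an influence array for the
vertex-star windows of `SU(2)` Wilson lattice gauge theory on `(ℤ/L)^4` with per-star received sum
`≤ ρ`; the cell's Lemma S / Lemma G propose one — pen-and-paper, NOT proved in the tree) with
`ρ < 1`. OUTPUT, kernel-checked GIVEN that input: the finite-volume, volume-uniform clustering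
currency of the crossover ledger, `CrossoverLedger.ExponentialClustering (fundamentalRep (Fin 2))
(β_W/2) κ` and `CrossoverLedger.StrongCouplingFront (fundamentalLatticeRep 2) (β₀W/2)`, at the rate
`κ = starRate ρ = (1 − ρ)²/(2(16ρ + 1))` — the SAME currency and units as the tree's single-link
front `su2_strongCouplingFront_of_oneLinkKRModulus` (`β_W < 2/9`-class). No statement about the
continuum, the mass gap, or any coupling where the hypothesis is not supplied.

Method (Föllmer 1988 Ch. I Thm. (2.13) route, as the tree's
`StrongCouplingTorusWindow.wilson_torusClustering_of_oneLinkKRModulus`): bounded measurable local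
observables are smoothed by the specification kernels of their supports (`specAvg`; the DLR equations
and properness leave the three integrals unchanged when the plaquette closure of one support misses
the other); the smoothed observables are link-Lipschitz (`isLipBound_specAvg_torusWeightSpec`, modulus
`M · wilsonSmoothLip 2 4 (β_W/2)` on the plaquette closure); the star door `su2Star_abs_covariance_le`
applies with `L₀ =` the periodic sup-distance between the endpoints of the two plaquette closures,
`≥ ‖x‖_∞ − D − 4` for supports of diameter `D` displaced by `x`.

Contents (this file): `starRate`, `torusNorm_fst_sub_linkEnds_le_one`,
`su2Star_abs_integral_mul_sub_le` (one torus: DLR smoothing + star door). The ledger currency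
(`su2Star_torusClustering`, `su2Star_exponentialClustering`, `su2Star_strongCouplingFront`) is the
sibling `StarFront.lean`.
-/

noncomputable section

open MeasureTheory ProbabilityTheory Function Finset
open Literature.Probability.LatticeModels
open Literature.Probability.LatticeModels.DobrushinMetric
open Literature.MathematicalPhysics.QuantumLattice (toTorusObservable IsCylinder IsLocalObservable
  LGConfig torusLift torusEdge groupHeatKernelMeasure fundamentalRep fundamentalLatticeRep)
open Literature.MathematicalPhysics.QuantumFieldTheory
open Literature.MathematicalPhysics.QuantumFieldTheory.Balaban1983to89
open Literature.MathematicalPhysics.QuantumFieldTheory.Balaban1983to89.StrongCouplingTorusWindow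

namespace Summit.Ventures.YMGap.DSWindow

/-- The clustering rate delivered by a star window bound with received sum `ρ`:
`κ(ρ) = (1 − ρ)²/(2(16ρ + 1))` (`N⋆ = 8`). -/
def starRate (ρ : ℝ) : ℝ := (1 - ρ) ^ 2 / (2 * (16 * ρ + 1))

/-- The star rate is positive for `0 ≤ ρ < 1`. -/
theorem starRate_pos {ρ : ℝ} (hρ0 : 0 ≤ ρ) (hρ1 : ρ < 1) : 0 < starRate ρ := by
  unfold starRate
  have h1 : 0 < 1 - ρ := sub_pos.2 hρ1
  positivity

section Torus

variable {L : ℕ} [NeZero L]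

omit [NeZero L] in
/-- An endpoint of a link is within periodic sup-distance `1` of its base point. -/
theorem torusNorm_fst_sub_linkEnds_le_one {d : ℕ} (y : Edge d L) {a : Site d L}
    (ha : a ∈ linkEnds y) : torusNorm (y.1 - a) ≤ 1 := by
  rcases mem_linkEnds.1 ha with rfl | rfl
  · rw [sub_self, torusNorm_zero]; exact zero_le_one
  · have h : y.1 - y.1.shift y.2 = -Pi.single y.2 1 := by
      simp [Literature.MathematicalPhysics.QuantumFieldTheory.Site.shift]
    rw [h, torusNorm_neg]
    refine Finset.sup_le fun k _ => ?_
    show ((Pi.single y.2 (1 : ZMod L) : Site d L) k).valMinAbs.natAbs ≤ 1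
    by_cases hk : k = y.2
    · subst hk; rw [Pi.single_eq_same]; exact natAbs_valMinAbs_one_le_one
    · rw [Pi.single_apply, if_neg hk]; simp

/-- **Covariance bound on one torus by DLR smoothing and the star door** (`SU(2)`, `d = 4`, Wilson
coupling `β_W`, torus side `L ≥ 2`): given `StarWindowBound L β_W ρ suFrobDist` with `ρ < 1`,
bounded measurable `f, g` depending on link sets `Δf, Δg` with `plaqClosure Δf` disjoint from `Δg`
and endpoints of `plaqClosure Δf`, `plaqClosure Δg` at periodic sup-distance `≥ L₀`:
`|μ(fg) − μ(f)μ(g)| ≤ 4 (2√2)² e^{−κ(ρ) L₀} (#plaqClosure Δf · M_f E)(#plaqClosure Δg · M_g E)`,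
`E = wilsonSmoothLip 2 4 (β_W/2)` (Föllmer 1988 Ch. I Thm. (2.13) route: smooth by `γ_{Δf}`,
`γ_{Δg}`, then `su2Star_abs_covariance_le`). -/
theorem su2Star_abs_integral_mul_sub_le (hL : 1 < L) (βW : ℝ) {ρ : ℝ} (hρ0 : 0 ≤ ρ) (hρ1 : ρ < 1)
    (hS : StarWindowBound L βW ρ suFrobDist)
    {f g : GaugeConfig 4 L (Matrix.specialUnitaryGroup (Fin 2) ℂ) → ℝ} (hfm : Measurable f)
    {Δf : Finset (Edge 4 L)} (hfdep : DependsOn f (↑Δf : Set (Edge 4 L))) {Mf : ℝ}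
    (hMf : ∀ σ, |f σ| ≤ Mf) (hgm : Measurable g) {Δg : Finset (Edge 4 L)}
    (hgdep : DependsOn g (↑Δg : Set (Edge 4 L))) {Mg : ℝ} (hMg : ∀ σ, |g σ| ≤ Mg)
    (hsep : ∀ y ∈ plaqClosure Δf, y ∉ Δg) (L₀ : ℕ)
    (hL₀ : ∀ y ∈ plaqClosure Δf, ∀ z ∈ plaqClosure Δg, ∀ a ∈ linkEnds y, ∀ w ∈ linkEnds z,
      L₀ ≤ torusNorm (a - w)) :
    |(∫ σ, f σ * g σ ∂(wilsonMeasure (d := 4) (L := L) (fundamentalRep (Fin 2)) (βW / 2))) -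
        (∫ σ, f σ ∂(wilsonMeasure (d := 4) (L := L) (fundamentalRep (Fin 2)) (βW / 2))) *
          ∫ σ, g σ ∂(wilsonMeasure (d := 4) (L := L) (fundamentalRep (Fin 2)) (βW / 2))| ≤
      4 * (2 * Real.sqrt 2) ^ 2 * Real.exp (-(starRate ρ * L₀)) *
        ((plaqClosure Δf).card * (Mf * wilsonSmoothLip 2 4 (βW / 2))) *
        ((plaqClosure Δg).card * (Mg * wilsonSmoothLip 2 4 (βW / 2))) := by
  classical
  haveI : SecondCountableTopology (Matrix (Fin 2) (Fin 2) ℂ) :=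
    inferInstanceAs (SecondCountableTopology (Fin 2 → Fin 2 → ℂ))
  haveI : SecondCountableTopology (Matrix.specialUnitaryGroup (Fin 2) ℂ) :=
    Topology.IsEmbedding.subtypeVal.secondCountableTopology
  have hv := continuous_wilsonPlaqWeight (N := 2) (βW / 2)
  have hv0 := wilsonPlaqWeight_pos (N := 2) (βW / 2)
  have hγ := isSpecification_torusWeightSpec (d := 4) (L := L) hv hv0
  have hG : IsGibbsMeasure (torusWeightSpec (d := 4) (L := L) (wilsonPlaqWeight 2 (βW / 2)))
      (wilsonMeasure (d := 4) (L := L) (fundamentalRep (Fin 2)) (βW / 2)) := by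
    rw [wilsonMeasure_eq_groupHeatKernelMeasure]; exact isGibbsMeasure_groupHeatKernelMeasure hv hv0
  set μ := wilsonMeasure (d := 4) (L := L) (fundamentalRep (Fin 2)) (βW / 2) with hμdef
  haveI : IsProbabilityMeasure μ := hG.isProbabilityMeasure
  set E : ℝ := wilsonSmoothLip 2 4 (βW / 2) with hEdef
  -- the smoothed observables
  set fb := specAvg (torusWeightSpec (d := 4) (L := L) (wilsonPlaqWeight 2 (βW / 2))) Δf f with hfb
  set gb := specAvg (torusWeightSpec (d := 4) (L := L) (wilsonPlaqWeight 2 (βW / 2))) Δg g with hgb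
  have hfbm : Measurable fb := measurable_specAvg hγ Δf hfm
  have hgbm : Measurable gb := measurable_specAvg hγ Δg hgm
  have hfbM : ∀ σ, |fb σ| ≤ Mf := abs_specAvg_le hγ Δf hMf
  have hgbM : ∀ σ, |gb σ| ≤ Mg := abs_specAvg_le hγ Δg hMg
  have hfbdep : DependsOn fb (↑(plaqClosure Δf) : Set (Edge 4 L)) :=
    dependsOn_specAvg_torusWeightSpec hv Δf hfm hfdep
  have hgbdep : DependsOn gb (↑(plaqClosure Δg) : Set (Edge 4 L)) :=
    dependsOn_specAvg_torusWeightSpec hv Δg hgm hgdep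
  have hvLip : ∀ (q : Plaquette 4 L) (y : Edge 4 L), y ∈ plaqEdgesT q →
      ∀ U U' : GaugeConfig 4 L (Matrix.specialUnitaryGroup (Fin 2) ℂ), (∀ z, z ≠ y → U z = U' z) →
      |Real.log (wilsonPlaqWeight 2 (βW / 2) (plaquetteHolonomy U q.1 q.2.1.1 q.2.1.2)) -
          Real.log (wilsonPlaqWeight 2 (βW / 2) (plaquetteHolonomy U' q.1 q.2.1.1 q.2.1.2))| ≤
        |βW / 2| * Real.sqrt (2 : ℕ) * suFrobDist (U y) (U' y) :=
    fun q y hy U U' hUU' => abs_log_wilsonPlaqWeight_hol_sub_le hL (βW / 2) q hy hUU'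
  have hD : (0 : ℝ) < 2 * Real.sqrt (2 : ℕ) := by positivity
  have hfbLip : IsLipBound suFrobDist fb fun _ => Mf * E := by
    rw [hEdef, wilsonSmoothLip]
    exact isLipBound_specAvg_torusWeightSpec hv hv0 suFrobDist_nonneg hD suFrobDist_le
      (by positivity) hvLip Δf hfm hfdep hMf
  have hgbLip : IsLipBound suFrobDist gb fun _ => Mg * E := by
    rw [hEdef, wilsonSmoothLip]
    exact isLipBound_specAvg_torusWeightSpec hv hv0 suFrobDist_nonneg hD suFrobDist_le
      (by positivity) hvLip Δg hgm hgdep hMg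
  -- DLR identities: smoothing does not change the three integrals
  have h1 : ∫ σ, f σ * g σ ∂μ = ∫ σ, fb σ * gb σ ∂μ := by
    have ha : ∫ η, fb η * g η ∂μ = ∫ σ, f σ * g σ ∂μ :=
      integral_specAvg_mul hγ hG Δf hfm hMf hgm hMg hgdep fun x hx => hsep x (subset_plaqClosure Δf hx)
    have hb : ∫ η, gb η * fb η ∂μ = ∫ σ, g σ * fb σ ∂μ :=
      integral_specAvg_mul hγ hG Δg hgm hMg hfbm hfbM hfbdep fun x hx hx' => hsep x hx' hx
    rw [← ha]
    have hb' : ∫ η, fb η * gb η ∂μ = ∫ σ, fb σ * g σ ∂μ := by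
      simp_rw [mul_comm (fb _)]
      exact hb
    exact hb'.symm
  have h2 : ∫ σ, f σ ∂μ = ∫ σ, fb σ ∂μ := (integral_specAvg hγ hG Δf hfm hMf).symm
  have h3 : ∫ σ, g σ ∂μ = ∫ σ, gb σ ∂μ := (integral_specAvg hγ hG Δg hgm hMg).symm
  rw [h1, h2, h3]
  -- the smoothed observables are admissible link observables on the plaquette closures
  have hE0 : 0 ≤ E := wilsonSmoothLip_nonneg (by norm_num) 4 (βW / 2)
  have hMf0 : 0 ≤ Mf := (abs_nonneg _).trans (hMf fun _ => 1)
  have hMg0 : 0 ≤ Mg := (abs_nonneg _).trans (hMg fun _ => 1)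
  have hfo : LinkObs suFrobDist fb (plaqClosure Δf) fun _ => Mf * E :=
    ⟨hfbm, ⟨Mf, hfbM⟩, hfbdep, fun _ => mul_nonneg hMf0 hE0, fun x σ τ h => hfbLip.le x σ τ h⟩
  have hgo : LinkObs suFrobDist gb (plaqClosure Δg) fun _ => Mg * E :=
    ⟨hgbm, ⟨Mg, hgbM⟩, hgbdep, fun _ => mul_nonneg hMg0 hE0, fun x σ τ h => hgbLip.le x σ τ h⟩
  have hR2 : (0 : ℝ) ≤ 2 * Real.sqrt 2 := by positivity
  have key := su2Star_abs_covariance_le (L := L) βW hR2 suFrobDist_le hρ0 hρ1 hS hfo hgo L₀ hL₀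
  rw [← hμdef] at key
  have hcov : cov[fb, gb; μ] = (∫ σ, fb σ * gb σ ∂μ) - (∫ σ, fb σ ∂μ) * ∫ σ, gb σ ∂μ := by
    rw [covariance_eq_sub]
    · rfl
    · exact memLp_of_bounded (a := -Mf) (b := Mf) (ae_of_all _ fun σ => abs_le.1 (hfbM σ))
        hfbm.aestronglyMeasurable 2
    · exact memLp_of_bounded (a := -Mg) (b := Mg) (ae_of_all _ fun σ => abs_le.1 (hgbM σ))
        hgbm.aestronglyMeasurable 2
  rw [hcov] at key
  simp only [Finset.sum_const, nsmul_eq_mul] at key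
  rw [starRate]
  exact key

end Torus

end Summit.Ventures.YMGap.DSWindow

end
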